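import Literature.NumberTheory.EllipticCurves.PNewBranchAnalyticChartTwoVariableBDP
import Summits.BirchSwinnertonDyer.BirchSwinnertonDyer.Theorems.EisensteinPrimesBSDpOnCellCTelescopeCarrierSplit
import Summits.BirchSwinnertonDyer.BirchSwinnertonDyer.Theorems.EisensteinPrimesBSDpOnCellCMemberInvariantsOfAnacongWt
import Summits.BirchSwinnertonDyer.Rank1Residual.X11b.FrameIdealRigidity
import HarnessLib

/-!
# Telescope line, crux 4 `BSDpOnCellC` (stmt-BirchSwinnertonDyer-19034): `stub_carrierAn` BY NAME from Castella's two-variable BDP function on the p-new branch chart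

The registered stub `stub_carrierAn` of the telescope skeleton (v4 645c0fbc… / v6 57975ee1…, text token for token) — the ANALYTIC
package of the two-variable carrier: a two-variable `L ∈ R₀⟦X⟧⟦T⟧` on an integral analytic chart of the Hida branch through `f_E`, member
fibres as remainders with the interpolation clauses (an_k)/(an∞), and the `q`-expansion chart clause — follows from the Literature named
fact `castella2020_exists_twoVariableBDP_on_pNewBranchChart` (ARM-P typer `bsd-armP-typer-19034-carrierAn`, p740333: Castella, J. Inst.
Math. Jussieu 19 (2020) Def. 2.10 / Thm. 2.11 / Rem. 2.12 on the chart of Hida, Invent. Math. 85 (1986) Thm. I / Cor. 1.4, with the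
`p`-new weight-2 fibre of Castella, Camb. J. Math. 6 (2018) §4 (4.1)).

Proof (the typer's validated bridge recipe, TYPING-MEMO-carrierAn-g0.md §4; this file is that OFFER verbatim, proposed by the LEAD):
`2 < p` and multiplicative reduction from `CellC`; instantiate the fact at `j := toUnr p`; (an∞) with exponent `e := 0` by the cross-period
rigidity of integral weight-2 BDP frames (`R1.span_singleton_eq_of_isBDPLFunctionInt`); (an_k) with `e := 0` from the ideal equality
`(Ψ_k) = (L_{g_k})` at the SAME CM periods. Standing riders of the named fact (typer flags T1-p3/T2-p3, T2-hK `p ∤ h_K` standing in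
Cas20 §1.2 and NOT a binder, T1-integral-chart, T2-sp-dictionary) travel with the fact, not with this bridge.

HONEST FRAMING: a by-name bridge from a HYPOTHESIS-SHAPED named fact; it proves no stub unconditionally, no crux, no summit statement;
BSD is proved for no curve by this file.
-/

set_option autoImplicit false
set_option linter.dupNamespace false

noncomputable section

open scoped Classical MatrixGroups ModularForm

open CongruenceSubgroup WeierstrassCurve NumberField IsDedekindDomain Field PowerSeries
  Literature.NumberTheory.EllipticCurves Literature.NumberTheory.EllipticCurves.GreenbergSelmer
  Literature.NumberTheory.EllipticCurves.ModularForms Literature.NumberTheory.QuadraticFields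
  Literature.NumberTheory.EllipticCurves.Rank1Residual
  Literature.NumberTheory.EllipticCurves.Rank1Residual.Typed
  Literature.NumberTheory.GaloisRepresentations Literature.NumberTheory.GaloisCohomology
  Summit.BirchSwinnertonDyer.Rank1Residual.X11b.AcSelmer
  Summit.BirchSwinnertonDyer.Rank1Residual.X11b.Halves
  Summit.BirchSwinnertonDyer.Rank1Residual.X11b
  Summit.BirchSwinnertonDyer.Rank1Residual Summit.BirchSwinnertonDyer.Rank1Residual.X1
  Summit.BirchSwinnertonDyer.Rank1Residual.X2
open Literature.NumberTheory.EllipticCurves.BigGaloisRep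
open Literature.NumberTheory.EllipticCurves.Castella2018

namespace Summit.BirchSwinnertonDyer.BirchSwinnertonDyer.Theorems.TelescopeCarrierAnOfCastella2020

open Summit.BirchSwinnertonDyer.BirchSwinnertonDyer.Theorems

/-- **`stub_carrierAn` BY NAME** — the registered telescope stub text (v4/v6, token for token) from the named fact
`castella2020_exists_twoVariableBDP_on_pNewBranchChart` (T-An-2; typer bsd-armP-typer-19034-carrierAn, p740333). Exponents `e := 0`
in both (an∞) (period rigidity of integral BDP frames) and (an_k) (ideal equality at the same CM periods).
[cite: Castella2020JIMJ, Def. 2.10, Thm. 2.11, Rem. 2.12 (J. Inst. Math. Jussieu 19; arXiv:1410.6591v3 Def. 1.3 / Thm. 1.4)]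
[cite: Castella2018, Thm. 3.1, §4 (4.1), p. 11 (Camb. J. Math. 6)] [cite: Hida1986, Thm. I, Cor. 1.4 (Invent. Math. 85)] -/
theorem carrierAn_of_castella2020 (h : castella2020_exists_twoVariableBDP_on_pNewBranchChart) :
    ∀ (W : WeierstrassCurve ℚ) [W.IsElliptic] [W.IsGloballyMinimal] (p : ℕ) [Fact p.Prime], ∀ (N : ℕ) [NeZero N] (K : Type) [Field K] [NumberField K] (Dt : ModularParametrizationData W N) (H : HeegnerDatum N (NumberField.discr K)) (ιK : K →+* ℂ) (P : (W.baseChange K).toAffine.Point), CellC W p → W.conductorNorm ℤ = N → IsImaginaryQuadratic K → NumberField.discr K < -4 → SatisfiesHeegnerHypothesis N K → (W.quadraticTwist (NumberField.discr K : ℚ)).entireLFunction 1 ≠ 0 → WeierstrassCurve.Affine.Point.map ιK.toRatAlgHom P = heegnerPointComplex Dt H → ¬ (p : ℤ) ∣ Dt.c → ¬ IsOfFinAddOrder P → Odd (NumberField.discr K) → ∀ (κ : ZpExtension K p), κ.IsAnticyclotomic → ∀ (γ : Field.absoluteGaloisGroup K) [Fact (κ.IsTopGenerator γ)] (𝔭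 : HeightOneSpectrum (𝓞 K)), ((p : ℕ) : 𝓞 K) ∈ 𝔭.asIdeal → 𝔭.asIdeal.ramificationIdx (𝓞 ℚ) = 1 → 𝔭.asIdeal.inertiaDeg (𝓞 ℚ) = 1 → ∀ (𝔭bar : HeightOneSpectrum (𝓞 K)), ((p : ℕ) : 𝓞 K) ∈ 𝔭bar.asIdeal → 𝔭bar ≠ 𝔭 → ((Ideal.span {(p : ℤ)}).primesOver (𝓞 K)).ncard = 2 → ∀ (f : CuspForm (CongruenceSubgroup.Gamma0 N) 2), IsNewformOf W f → ∀ (ι' : PadicAlgCl p ≃+* ℂ), (∀ (w : InfinitePlace K) (k : 𝓞 K), k ∈ 𝔭.asIdeal ↔ ‖ι'.symm (w.embedding (k : K))‖ < 1) → ∀ (ΩK : ℂ) (Ωp : ℂ_[p]) (Q : PowerSeries 𝓞_ℂ_[p]), ΩK ≠ 0 → ‖Ωp‖ = 1 → R1.IsBDPLFunctionInt p ι' 𝔭 κ γ f ΩK Ωp Q → ∃ (L : PowerSeries (PowerSeries (unrIntegers p))) (x : ℕ → ℤ_[p]) (D : ℕ → Skinner2016.HidaCongruentForm W p 1), (∀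 k, ‖x k‖ < 1) ∧ Filter.Tendsto x Filter.atTop (nhds 0) ∧ (∃ e : ℕ, PowerSeries.C ((p : 𝓞_ℂ_[p]) ^ e) * Q ∈ Ideal.span {PowerSeries.map (R1.unrToCpInt p) (PowerSeries.map (PowerSeries.constantCoeff (R := unrIntegers p)) L)}) ∧ (∀ k : ℕ, (∀ y : coeffField (D k).g, ι' ((D k).ι y) = (y : ℂ)) ∧ 2 * ((p : ℤ) - 1) ∣ (D k).k - 2 ∧ ∃ (ΩKg : ℂ) (Ωpg : ℂ_[p]) (Lg : UnrSeries p), ΩKg ≠ 0 ∧ ‖Ωpg‖ = 1 ∧ IsBDPLFunctionWt ι' 𝔭 κ γ (D k).g ΩKg Ωpg Lg ∧ ∃ Ψ : UnrSeries p, (∃ U : PowerSeries (PowerSeries (unrIntegers p)), PowerSeries.map (PowerSeries.C (R := unrIntegers p)) Ψ = L + PowerSeries.C (PowerSeries.X - PowerSeries.C (toUnr p (x k))) * U) ∧ (∃ e : ℕ, PowerSeries.C ((p : 𝓞_ℂ_[p]) ^ e) * PowerSeries.map (R1.unrToCpInt p) Ψ ∈ Ideal.span {PowerSeries.map (R1.unrToCpInt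 p) Lg})) ∧ (∃ A : ℕ → UnrSeries p, ∀ ℓ : ℕ, ℓ.Prime → ¬ ℓ ∣ N → (∃ U : UnrSeries p, A ℓ = PowerSeries.C (toUnr p ((W.frobeniusTrace ℓ : ℤ) : ℤ_[p])) + PowerSeries.X * U) ∧ ∀ k : ℕ, ∃ (c : unrIntegers p) (U : UnrSeries p), A ℓ = PowerSeries.C c + (PowerSeries.X - PowerSeries.C (toUnr p (x k))) * U ∧ ((c : ℂ_[p]) = algebraMap (PadicAlgCl p) ℂ_[p] ((D k).ι ⟨(UpperHalfPlane.qExpansion 1 ⇑(D k).g).coeff ℓ, coeff_mem_coeffField (D k).g ℓ⟩))) := by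
  intro W _ _ p _ N _ K _ _ Dt H ιK P hC hN hK hdisc hH _hL1 _hP _hc _hPinf hodd κ hκ γ _ 𝔭 h𝔭 _hram _hdeg
    𝔭bar _h𝔭bar _hne hsplit f hf ι' hι' ΩK Ωp Q hΩK hΩp hQ
  have hp2 : 2 < p := MemberInvariantsOfAnacongWt.two_lt_of_cellC hC
  have hmult := MemberInvariantsOfAnacongWt.mult_of_cellC hC
  subst hN
  obtain ⟨A, x, D, hchart, ΩK', Ωp', L, hΩK', ⟨L₂, hL₂, hspan⟩, hfib⟩ :=
    h ι' W K 𝔭 κ γ hf rfl hp2 hmult hK hodd hdisc hH hsplit h𝔭 hι' hκ (toUnr p) (coe_toUnr p)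
  have hΩp'1 : ‖((Ωp' : unrIntegers p) : ℂ_[p])‖ = 1 := norm_coe_units_unrIntegers p Ωp'
  have hΩp'0 : ((Ωp' : unrIntegers p) : ℂ_[p]) ≠ 0 := by
    intro h0; rw [h0, norm_zero] at hΩp'1; exact zero_ne_one hΩp'1
  have hΩp0 : Ωp ≠ 0 := by
    intro h0; rw [h0, norm_zero] at hΩp; exact zero_ne_one hΩp
  refine ⟨L, x, D, hchart.1, hchart.2.1, ?_, fun k ↦ ⟨(hchart.2.2.1 k).1, (hchart.2.2.1 k).2, ?_⟩,
    A, hchart.2.2.2.1⟩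
  · -- (an∞): e := 0, by cross-period rigidity of the weight-2 frames
    refine ⟨0, ?_⟩
    have hQ₂ : R1.IsBDPLFunctionInt p ι' 𝔭 κ γ f ΩK' ((Ωp' : unrIntegers p) : ℂ_[p])
        (PowerSeries.map (R1.unrToCpInt p) L₂) := R1.isBDPLFunctionInt_map hL₂
    have hrig : Ideal.span ({Q} : Set (PowerSeries 𝓞_ℂ_[p])) =
        Ideal.span {PowerSeries.map (R1.unrToCpInt p) L₂} :=
      R1.span_singleton_eq_of_isBDPLFunctionInt hp2.ne' hK hκ Fact.out hΩK' hΩK hΩp'0 hΩp0 hQ₂ hQ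
    have hmap : Ideal.span {PowerSeries.map (R1.unrToCpInt p)
          (PowerSeries.map (PowerSeries.constantCoeff (R := unrIntegers p)) L)} =
        Ideal.span {PowerSeries.map (R1.unrToCpInt p) L₂} := by
      have := congrArg (Ideal.map (PowerSeries.map (R1.unrToCpInt p))) hspan
      simpa only [Ideal.map_span, Set.image_singleton] using this
    rw [pow_zero, map_one, one_mul, hmap, ← hrig]
    exact Ideal.mem_span_singleton_self Q
  · -- (an_k): the member frame at the SAME periods; e := 0 from the ideal equality
    obtain ⟨Ψ, Lg, hΨ, hLg, hspanΨ⟩ := hfib k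
    refine ⟨ΩK', ((Ωp' : unrIntegers p) : ℂ_[p]), Lg, hΩK', hΩp'1, hLg, Ψ, hΨ, 0, ?_⟩
    have hmem : Ψ ∈ Ideal.span {Lg} := hspanΨ ▸ Ideal.mem_span_singleton_self Ψ
    obtain ⟨a, ha⟩ := Ideal.mem_span_singleton'.mp hmem
    rw [pow_zero, map_one, one_mul, ← ha, map_mul]
    exact Ideal.mul_mem_left _ _ (Ideal.mem_span_singleton_self _)

end Summit.BirchSwinnertonDyer.BirchSwinnertonDyer.Theorems.TelescopeCarrierAnOfCastella2020

end
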